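import Mathlib
import HarnessLib

/-!
# The two wall rays of the fold: the chirp's slope and the stationary-phase intensity `τ²/|τ² − 2|`

Helper file (`--supports stmt-RiemannHypothesis-0098`), elementary real analysis, no definitions.  Seat rh-explicit-weil-5 gen13
(file of record `HOME/rh-explicit-weil-5/WEIL5-XFOLD.md` §1(c)); companion of `Theorems/WeilFoldOptics.lean`, which starts from
the ray intensities `w/|w − 2|` (`w = τ²`) and proves them equal to `g/√(g² − 1)`.  This file supplies the step before: for the
`χ = 0` transport chirp `ω(τ) = cτ²/√(τ² − 1)` (height `γ = ω(τ)` of the ray at depth `ln τ`),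

* `hasDerivAt_chirp`        : `ω′(τ) = cτ(τ² − 2)/(τ² − 1)^{3/2}` for `τ > 1` — so `ω` decreases on `(1, √2)`, increases on
  `(√2, ∞)` and folds at `τ² = 2`, `ω = 2c` (the sign statements `chirp_slope_neg/pos`);
* `ray_intensity_eq`        : the stationary-phase intensity of a ray in far-wall units,
  `γ² · (E²/4) · 2π/(τ·|ω′(τ)|)` with `E² = 2/(πc√(τ² − 1))` and `γ = ω(τ)`, equals `τ²/|τ² − 2|` (`τ > 1`, `τ² ≠ 2`).

Standard axioms only; no `sorry`.
-/

set_option linter.dupNamespace false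
set_option autoImplicit false

noncomputable section

open Real

namespace Summit.RiemannHypothesis.RiemannHypothesis.Theorems.WeilFoldRays

/-- For `τ > 1`: `√(τ² − 1) > 0`. -/
private theorem sqrt_pos_of_one_lt {τ : ℝ} (hτ : 1 < τ) : 0 < Real.sqrt (τ ^ 2 - 1) :=
  Real.sqrt_pos.mpr (by nlinarith)

/-- THE CHIRP'S SLOPE: for `τ > 1`, `d/dτ [c·τ²/√(τ² − 1)] = c·τ·(τ² − 2)/(τ² − 1)^{3/2}`,
written with `(τ² − 1)^{3/2} = (τ² − 1)·√(τ² − 1)`. -/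
theorem hasDerivAt_chirp (c τ : ℝ) (hτ : 1 < τ) :
    HasDerivAt (fun t : ℝ => c * t ^ 2 / Real.sqrt (t ^ 2 - 1))
      (c * τ * (τ ^ 2 - 2) / ((τ ^ 2 - 1) * Real.sqrt (τ ^ 2 - 1))) τ := by
  have hpos : 0 < τ ^ 2 - 1 := by nlinarith
  have hs : 0 < Real.sqrt (τ ^ 2 - 1) := sqrt_pos_of_one_lt hτ
  have hsq : Real.sqrt (τ ^ 2 - 1) ^ 2 = τ ^ 2 - 1 := Real.sq_sqrt hpos.le
  -- numerator: c t² ; denominator: √(t² − 1)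
  have hnum : HasDerivAt (fun t : ℝ => c * t ^ 2) (c * (2 * τ)) τ := by
    simpa using ((hasDerivAt_pow 2 τ).const_mul c)
  have hinner : HasDerivAt (fun t : ℝ => t ^ 2 - 1) (2 * τ) τ := by
    simpa using (hasDerivAt_pow 2 τ).sub_const 1
  have hden : HasDerivAt (fun t : ℝ => Real.sqrt (t ^ 2 - 1)) (2 * τ / (2 * Real.sqrt (τ ^ 2 - 1))) τ :=
    hinner.sqrt hpos.ne'
  have h := hnum.div hden hs.ne'
  refine h.congr_deriv ?_
  field_simp
  rw [hsq]
  ring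

/-- Below the fold depth (`1 < τ`, `τ² < 2`) the chirp decreases: the inner (near-wall) ray. -/
theorem chirp_slope_neg (c τ : ℝ) (hc : 0 < c) (hτ : 1 < τ) (h2 : τ ^ 2 < 2) :
    c * τ * (τ ^ 2 - 2) / ((τ ^ 2 - 1) * Real.sqrt (τ ^ 2 - 1)) < 0 := by
  have hpos : 0 < τ ^ 2 - 1 := by nlinarith
  have hs := sqrt_pos_of_one_lt hτ
  have hnum : c * τ * (τ ^ 2 - 2) < 0 := by
    have : 0 < c * τ := by positivity
    nlinarith
  exact div_neg_of_neg_of_pos hnum (by positivity)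

/-- Beyond the fold depth (`τ² > 2`) the chirp increases: the outer (far-wall) ray. -/
theorem chirp_slope_pos (c τ : ℝ) (hc : 0 < c) (hτ : 1 < τ) (h2 : 2 < τ ^ 2) :
    0 < c * τ * (τ ^ 2 - 2) / ((τ ^ 2 - 1) * Real.sqrt (τ ^ 2 - 1)) := by
  have hpos : 0 < τ ^ 2 - 1 := by nlinarith
  have hs := sqrt_pos_of_one_lt hτ
  have hnum : 0 < c * τ * (τ ^ 2 - 2) := by
    have : 0 < c * τ := by positivity
    nlinarith
  positivity

/-- THE RAY INTENSITY IN FAR-WALL UNITS.  With `γ = ω(τ) = cτ²/√(τ²−1)`, `E² = 2/(π c √(τ²−1))` and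
`|ω′(τ)| = cτ|τ²−2|/((τ²−1)√(τ²−1))`, the stationary-phase weight `γ²·(E²/4)·2π/(τ·|ω′(τ)|)` equals `τ²/|τ² − 2|`
(`c > 0`, `τ > 1`, `τ² ≠ 2`).  `Theorems/WeilFoldOptics.lean` takes it from here (`w/|w−2|` with `w = τ²`). -/
theorem ray_intensity_eq (c τ : ℝ) (hc : 0 < c) (hτ : 1 < τ) (h2 : τ ^ 2 ≠ 2) :
    (c * τ ^ 2 / Real.sqrt (τ ^ 2 - 1)) ^ 2 * ((2 / (π * c * Real.sqrt (τ ^ 2 - 1))) / 4)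
        * (2 * π / (τ * (c * τ * |τ ^ 2 - 2| / ((τ ^ 2 - 1) * Real.sqrt (τ ^ 2 - 1)))))
      = τ ^ 2 / |τ ^ 2 - 2| := by
  have hpos : 0 < τ ^ 2 - 1 := by nlinarith
  have hs : 0 < Real.sqrt (τ ^ 2 - 1) := sqrt_pos_of_one_lt hτ
  have hsq : Real.sqrt (τ ^ 2 - 1) ^ 2 = τ ^ 2 - 1 := Real.sq_sqrt hpos.le
  have hτ0 : 0 < τ := by linarith
  have habs : 0 < |τ ^ 2 - 2| := abs_pos.mpr (sub_ne_zero.mpr h2)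
  have hπ : 0 < π := Real.pi_pos
  field_simp
  nlinarith [hsq, hs, habs, hτ0, hc, hπ]

end Summit.RiemannHypothesis.RiemannHypothesis.Theorems.WeilFoldRays

end
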